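import Literature.Analysis.FluidPDE.AlbrittonBlowupCriterionContinuation
import HarnessLib

/-!
# Albritton's blow-up criterion: the local-regularity reading is a corollary of Theorem 1.1

Proof-only sibling (no definition, no named fact) of `Literature.Analysis.FluidPDE.AlbrittonBlowupCriterion`
(`albritton_singular_point_of_blowup` = D. Albritton, *Blow-up criteria for the Navier–Stokes
equations in non-endpoint critical Besov spaces*, Anal. PDE 11 (2018) 1415–1456 =
arXiv:1612.04439, **Cor. 4.6**) and of `CriticalRegularity.lean` (the named fact
`Literature.Analysis.FluidPDE.albritton_besov_blowup` = **Thm. 1.1**: at a finite maximal time the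
critical Besov norm of a Besov mild solution tends to `∞`).

## History of this file (review of the decomposition, 2026-08-15)

The first decomposition of `albritton_besov_blowup` (`AlbrittonBlowupCriterion.lean`) had vendored,
next to Cor. 4.6, a second named fact `albritton_regular_of_liminf_besov` — "§3, proof of
Thm. 1.1, Steps 1–3": *a Besov mild solution on `[0, T)` of the diagonal class `(s_p, p, p)` with
`liminf_{t ↑ T} ‖U t‖_{Ḃ^{s_p}_{p,p}} < ∞` is essentially bounded on some backward cylinder
`Q_r(T, x₀)` at every `x₀`* — and this file assembled Thm. 1.1 from the two
(`albritton_besov_blowup_of_albritton`). On review of that split (D-0026) the second fact was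
**retired** and merged back into the proof obligation of `albritton_besov_blowup`:

* it is not a distinct printed result but the body of the printed proof by contradiction
  (arXiv:1612.04439, §3, pp. 15–16: rescaling under (3.2), the Calderón limit `v` with
  `v(·, 1) = 0`, backward uniqueness and unique continuation, "This contradicts that `v` is
  singular at time `T = 1`"), whose discharge is the whole of §2 (Calderón solutions,
  Thms. 2.5–2.7), §4.3 (Thm. 4.2) and §4.4 (Thm. 4.8, Prop. 4.9, Thms. 4.10–4.11) — theory-sized;
* over the tree's solution class it is moreover **a corollary of the parent fact itself**, which
  is what this file now proves: `albritton_besov_blowup.eLpNorm_uncurry_top_parabolicCylinder_lt_top`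
  and `albritton_besov_blowup.regular_of_frequently_le` — assume `albritton_besov_blowup`; if a Besov
  mild solution `(u, U)` on `[0, T)` (any class `(s_p, p, q)`, `3 < p, q < ∞`) has
  `‖U t‖_{Ḃ^{s_p}_{p,q}} ≤ M` frequently as `t ↑ T` (Albritton's hypothesis (3.2)), then by Thm. 1.1
  read as a continuation criterion (`albritton_besov_blowup.exists_extension`,
  `AlbrittonBlowupCriterionContinuation.lean`) `T` is not maximal: some Besov mild solution
  `(v, V)` on `[0, T')`, `T' > T`, agrees with `u` a.e. at every time of `[0, T)`; `v` lies in
  Kato's class `K_∞` on `[0, T')`, so `sup_{0<τ<T} √τ ‖v(τ)‖_∞ < ∞` and `v` — hence `u` — is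
  essentially bounded on every cylinder `Q_r(T, x₀) = (T - r², T) × B(x₀, r)` with `r² < T`
  (Tonelli on strongly measurable representatives: `eLpNorm_top_prod_le_of_ae_slice`,
  `ae_eq_prod_of_ae_forall_slice`). So "Cor. 4.6 + the retired fact ⟹ Thm. 1.1" (the old
  assembly) and "Thm. 1.1 ⟹ the retired fact" (this file): the split had cut the parent into
  Cor. 4.6 and a restatement of itself.

What remains vendored from Albritton 2018 is Thm. 1.1 (`albritton_besov_blowup`) and Cor. 4.6
(`albritton_singular_point_of_blowup`); both are stated over the tree's class
`IsBesovMildSolutionOn` / `IsMaximalBesovMildSolution`, which is larger than Albritton's uniqueness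
class (4.52) — see `AlbrittonBlowupCriterionKato.lean` and `AlbrittonBlowupCriterionPathSpace.lean`
for that (separate) faithfulness record. Nothing accepted is restated; no statement of the tree is
changed here.

## References

* D. Albritton, *Blow-up criteria for the Navier–Stokes equations in non-endpoint critical Besov
  spaces*, Anal. PDE 11 (2018) 1415–1456 = arXiv:1612.04439: Thm. 1.1 (p. 4); §3, proof of
  Thm. 1.1, hypothesis (3.2) and Steps 1–3 (pp. 15–16); Thm. 4.2 (i) (p. 20: `T* < ∞` forces
  `‖u(t)‖_{L^∞} → ∞`); §4.4 (singular points, `Q(z₀, R) = B(x₀, R) × (t₀ - R², t₀)`).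
  [cite: Albritton2018, Thm. 1.1]
* L. Caffarelli, R. Kohn, L. Nirenberg, Comm. Pure Appl. Math. 35 (1982), §2 (the cylinders
  `parabolicCylinder`). [cite: CKN1982, §2]
-/

noncomputable section

open MeasureTheory Set Function Filter Metric
open _root_.Topology
open scoped SchwartzMap ENNReal NNReal

namespace Literature.Analysis.FluidPDE

/-! ### Tonelli glue: slice-wise bounds and slice-wise a.e. equality on a product -/

section Slices

variable {α β : Type*} [MeasurableSpace α] [MeasurableSpace β] {μ : Measure α} {ν : Measure β}
  [SFinite ν]

/-- **An `L^∞` bound slice by slice is an `L^∞` bound on the product** (Tonelli): if `f` is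
a.e.-strongly measurable for `μ ⊗ ν` and `‖f(a, ·)‖_{L^∞(ν)} ≤ C` for `μ`-a.e. `a`, then
`‖f‖_{L^∞(μ ⊗ ν)} ≤ C`. Proof: pass to a strongly measurable representative `g`, whose sub-level
set `{‖g‖ₑ ≤ C}` is measurable, and use `Measure.ae_prod_mem_iff_ae_ae_mem`. (Joint measurability
is essential.) [folklore] -/
theorem eLpNorm_top_prod_le_of_ae_slice {G : Type*} [NormedAddCommGroup G] {f : α × β → G}
    (hf : AEStronglyMeasurable f (μ.prod ν)) {C : ℝ≥0∞}
    (h : ∀ᵐ a ∂μ, eLpNorm (fun b => f (a, b)) ∞ ν ≤ C) : eLpNorm f ∞ (μ.prod ν) ≤ C := by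
  rw [eLpNorm_exponent_top]
  refine essSup_le_of_ae_le C ?_
  have hS : MeasurableSet {z | ‖hf.mk f z‖ₑ ≤ C} :=
    measurableSet_le hf.stronglyMeasurable_mk.enorm measurable_const
  have h1 : ∀ᵐ a ∂μ, ∀ᵐ b ∂ν, f (a, b) = hf.mk f (a, b) := Measure.ae_ae_of_ae_prod hf.ae_eq_mk
  have h2 : ∀ᵐ a ∂μ, ∀ᵐ b ∂ν, (a, b) ∈ {z | ‖hf.mk f z‖ₑ ≤ C} := by
    filter_upwards [h, h1] with a ha h1a
    have hb : ∀ᵐ b ∂ν, ‖f (a, b)‖ₑ ≤ C := by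
      rw [eLpNorm_exponent_top] at ha
      filter_upwards [ae_le_eLpNormEssSup (f := fun b => f (a, b)) (μ := ν)] with b hb
      exact hb.trans ha
    filter_upwards [hb, h1a] with b hb h1b
    show ‖hf.mk f (a, b)‖ₑ ≤ C
    rwa [← h1b]
  filter_upwards [(Measure.ae_prod_mem_iff_ae_ae_mem hS).2 h2, hf.ae_eq_mk] with z hz hfz
  show ‖f z‖ₑ ≤ C
  rw [hfz]
  exact hz

/-- **Slice-wise a.e. equal jointly measurable functions are a.e. equal on the product**
(Tonelli; the twin of `ae_eq_prod_of_ae_slice_ae_eq` of `ChaeWolfLocalLeray.lean`, reproved here to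
keep the import closure small): strongly measurable representatives have a measurable coincidence
set, to which `Measure.ae_prod_mem_iff_ae_ae_mem` applies. [folklore] -/
theorem ae_eq_prod_of_ae_forall_slice {G : Type*} [TopologicalSpace G]
    [TopologicalSpace.MetrizableSpace G] {f g : α × β → G}
    (hf : AEStronglyMeasurable f (μ.prod ν)) (hg : AEStronglyMeasurable g (μ.prod ν))
    (h : ∀ᵐ a ∂μ, (fun b => f (a, b)) =ᵐ[ν] fun b => g (a, b)) : f =ᵐ[μ.prod ν] g := by
  have hS : MeasurableSet {z | hf.mk f z = hg.mk g z} :=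
    hf.stronglyMeasurable_mk.measurableSet_eq_fun hg.stronglyMeasurable_mk
  have h1 : ∀ᵐ a ∂μ, ∀ᵐ b ∂ν, f (a, b) = hf.mk f (a, b) := Measure.ae_ae_of_ae_prod hf.ae_eq_mk
  have h2 : ∀ᵐ a ∂μ, ∀ᵐ b ∂ν, g (a, b) = hg.mk g (a, b) := Measure.ae_ae_of_ae_prod hg.ae_eq_mk
  have h3 : ∀ᵐ a ∂μ, ∀ᵐ b ∂ν, (a, b) ∈ {z | hf.mk f z = hg.mk g z} := by
    filter_upwards [h, h1, h2] with a ha h1a h2a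
    filter_upwards [ha, h1a, h2a] with b hb h1b h2b
    show hf.mk f (a, b) = hg.mk g (a, b)
    rw [← h1b, ← h2b, hb]
  filter_upwards [(Measure.ae_prod_mem_iff_ae_ae_mem hS).2 h3, hf.ae_eq_mk, hg.ae_eq_mk] with z hz
    hfz hgz
  rw [hfz, hgz]
  exact hz

end Slices

/-! ### Kato's class bounds a solution on the backward cylinders below its lifespan -/

section Kato

variable {T T' : ℝ} {u v : ℝ → EuclideanSpace ℝ (Fin 3) → EuclideanSpace ℝ (Fin 3)}

/-- The volume on `ℝ × ℝ³` restricted to a backward parabolic cylinder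
`Q_r(T, x₀) = (T - r², T) × B(x₀, r)` is the product of the restricted volumes (CKN 1982, §2;
`Measure.prod_restrict`). [cite: CKN1982, §2] -/
theorem volume_restrict_parabolicCylinder_eq_prod (r T : ℝ) (x₀ : EuclideanSpace ℝ (Fin 3)) :
    (volume : Measure (ℝ × EuclideanSpace ℝ (Fin 3))).restrict (parabolicCylinder r (T, x₀)) =
      ((volume : Measure ℝ).restrict (Ioo (T - r ^ 2) T)).prod
        ((volume : Measure (EuclideanSpace ℝ (Fin 3))).restrict (ball x₀ r)) := by
  rw [Measure.prod_restrict, ← Measure.volume_eq_prod]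
  rfl

/-- **A member of Kato's class `K_∞` on `[0, T')` is essentially bounded on every backward
cylinder `Q_r(T, x₀)` with `r² < T < T'`** (Albritton 2018, Thm. 4.2 (4.52): `u ∈ K̊_∞(Q_T)`
for `T < T*`, so `u ∈ L^∞(ℝ³ × (δ, T))`; here through the tree's `MemKatoClassOn`:
`sup_{0<τ<T} √τ ‖v(τ)‖_∞ =: K < ∞`, and on `(T - r², T)` the weight is at least `√(T - r²) > 0`,
so `‖v(τ)‖_∞ ≤ K / √(T - r²)`; joint measurability turns the slice bounds into a bound on the
cylinder, `eLpNorm_top_prod_le_of_ae_slice`). [cite: Albritton2018, Thm. 4.2 (4.52)] -/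
theorem MemKatoClassOn.eLpNorm_uncurry_top_parabolicCylinder_lt_top (hv : MemKatoClassOn T' v)
    (hmeas : AEStronglyMeasurable (uncurry v) (volume.restrict (Ioo 0 T' ×ˢ univ)))
    (hTT' : T < T') (x₀ : EuclideanSpace ℝ (Fin 3)) {r : ℝ} (hrT : r ^ 2 < T) :
    eLpNorm (uncurry v) ∞ (volume.restrict (parabolicCylinder r (T, x₀))) < ∞ := by
  -- the Kato bound on `(0, T)`
  set K : ℝ≥0∞ := ⨆ τ ∈ Ioo 0 T, ENNReal.ofReal (Real.sqrt τ) * eLpNorm (v τ) ∞ volume with hK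
  have hKlt : K < ∞ := hv.1 T hTT'
  -- the positive lower bound of the weight on `(T - r², T)`
  have hr0 : 0 < T - r ^ 2 := sub_pos.2 hrT
  set c : ℝ≥0∞ := ENNReal.ofReal (Real.sqrt (T - r ^ 2)) with hc
  have hc0 : c ≠ 0 := by
    rw [hc]
    exact (ENNReal.ofReal_pos.2 (Real.sqrt_pos.2 hr0)).ne'
  -- slice bounds: `‖v τ‖_∞ ≤ K / c` for `τ ∈ (T - r², T)`
  have hslice : ∀ τ ∈ Ioo (T - r ^ 2) T, eLpNorm (v τ) ∞ volume ≤ K / c := by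
    intro τ hτ
    have hτ0 : 0 < τ := hr0.trans hτ.1
    have hle : ENNReal.ofReal (Real.sqrt τ) * eLpNorm (v τ) ∞ volume ≤ K := by
      rw [hK]
      exact le_iSup₂ (f := fun (τ : ℝ) (_ : τ ∈ Ioo 0 T) =>
        ENNReal.ofReal (Real.sqrt τ) * eLpNorm (v τ) ∞ volume) τ ⟨hτ0, hτ.2⟩
    have hcτ : c ≤ ENNReal.ofReal (Real.sqrt τ) :=
      ENNReal.ofReal_le_ofReal (Real.sqrt_le_sqrt hτ.1.le)
    rw [ENNReal.le_div_iff_mul_le (Or.inl hc0) (Or.inl ENNReal.ofReal_ne_top)]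
    calc eLpNorm (v τ) ∞ volume * c ≤ eLpNorm (v τ) ∞ volume * ENNReal.ofReal (Real.sqrt τ) := by
          gcongr
      _ = ENNReal.ofReal (Real.sqrt τ) * eLpNorm (v τ) ∞ volume := mul_comm _ _
      _ ≤ K := hle
  -- joint measurability on the cylinder
  have hsub : parabolicCylinder r (T, x₀) ⊆ Ioo 0 T' ×ˢ (univ : Set (EuclideanSpace ℝ (Fin 3))) :=
    prod_mono (Ioo_subset_Ioo hr0.le hTT'.le) (subset_univ _)
  have hmeas' : AEStronglyMeasurable (uncurry v)
      (((volume : Measure ℝ).restrict (Ioo (T - r ^ 2) T)).prod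
        ((volume : Measure (EuclideanSpace ℝ (Fin 3))).restrict (ball x₀ r))) := by
    rw [← volume_restrict_parabolicCylinder_eq_prod]
    exact hmeas.mono_measure (Measure.restrict_mono hsub le_rfl)
  -- Tonelli
  have hbound : eLpNorm (uncurry v) ∞ (volume.restrict (parabolicCylinder r (T, x₀))) ≤ K / c := by
    rw [volume_restrict_parabolicCylinder_eq_prod]
    refine eLpNorm_top_prod_le_of_ae_slice hmeas' ?_
    refine (ae_restrict_iff' measurableSet_Ioo).2 (Eventually.of_forall fun τ hτ => ?_)
    exact (eLpNorm_mono_measure _ Measure.restrict_le_self).trans (hslice τ hτ)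
  exact hbound.trans_lt (ENNReal.div_lt_top hKlt.ne hc0)

/-- **Essential boundedness on a cylinder passes between solutions agreeing a.e. slice by slice**:
if `v t = u t` a.e. for every `t ∈ [0, T)` and both fields are jointly a.e.-strongly measurable
on the strips containing the cylinder `Q_r(T, x₀)`, `r² < T ≤ T'`, then
`‖u‖_{L^∞(Q_r(T, x₀))} = ‖v‖_{L^∞(Q_r(T, x₀))}` (`ae_eq_prod_of_ae_forall_slice`). [folklore] -/
theorem eLpNorm_uncurry_top_parabolicCylinder_congr
    (humeas : AEStronglyMeasurable (uncurry u) (volume.restrict (Ioo 0 T ×ˢ univ)))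
    (hvmeas : AEStronglyMeasurable (uncurry v) (volume.restrict (Ioo 0 T' ×ˢ univ)))
    (hTT' : T ≤ T') (hvu : ∀ t ∈ Ico 0 T, v t =ᵐ[volume] u t) (x₀ : EuclideanSpace ℝ (Fin 3))
    {r : ℝ} (hrT : r ^ 2 < T) :
    eLpNorm (uncurry u) ∞ (volume.restrict (parabolicCylinder r (T, x₀))) =
      eLpNorm (uncurry v) ∞ (volume.restrict (parabolicCylinder r (T, x₀))) := by
  have hr0 : 0 < T - r ^ 2 := sub_pos.2 hrT
  have hsubu : parabolicCylinder r (T, x₀) ⊆ Ioo 0 T ×ˢ (univ : Set (EuclideanSpace ℝ (Fin 3))) :=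
    prod_mono (Ioo_subset_Ioo_left hr0.le) (subset_univ _)
  have hsubv : parabolicCylinder r (T, x₀) ⊆ Ioo 0 T' ×ˢ (univ : Set (EuclideanSpace ℝ (Fin 3))) :=
    prod_mono (Ioo_subset_Ioo hr0.le hTT') (subset_univ _)
  have humeas' : AEStronglyMeasurable (uncurry u)
      (((volume : Measure ℝ).restrict (Ioo (T - r ^ 2) T)).prod
        ((volume : Measure (EuclideanSpace ℝ (Fin 3))).restrict (ball x₀ r))) := by
    rw [← volume_restrict_parabolicCylinder_eq_prod]
    exact humeas.mono_measure (Measure.restrict_mono hsubu le_rfl)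
  have hvmeas' : AEStronglyMeasurable (uncurry v)
      (((volume : Measure ℝ).restrict (Ioo (T - r ^ 2) T)).prod
        ((volume : Measure (EuclideanSpace ℝ (Fin 3))).restrict (ball x₀ r))) := by
    rw [← volume_restrict_parabolicCylinder_eq_prod]
    exact hvmeas.mono_measure (Measure.restrict_mono hsubv le_rfl)
  rw [volume_restrict_parabolicCylinder_eq_prod]
  refine eLpNorm_congr_ae (ae_eq_prod_of_ae_forall_slice humeas' hvmeas' ?_)
  refine (ae_restrict_iff' measurableSet_Ioo).2 (Eventually.of_forall fun t ht => ?_)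
  exact ae_restrict_of_ae (hvu t ⟨(hr0.trans ht.1).le, ht.2⟩).symm

end Kato

/-! ### The retired half is a corollary of Theorem 1.1 -/

-- `linter.deprecated` is switched off for the next declaration only: its hypothesis is the
-- deprecated (mis-stated, 2026-08-15) tree-class rendering `albritton_besov_blowup` of Thm. 1.1
-- (`CriticalRegularity.lean`), kept as such until the faithful `albritton_besov_blowup_pathSpace`
-- is vendored; the corollary records what the vendored `Prop` implies over the tree's class.
set_option linter.deprecated false in
/-- **Theorem 1.1 bounds a solution with a finite `liminf` on every backward cylinder at `T`.**
Assume `albritton_besov_blowup` (Albritton 2018, Thm. 1.1). Let `ν > 0`, `3 < p, q < ∞`, `0 < T`,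
and let `(u, U)` be a Besov mild solution on `[0, T)` of the class `(s_p, p, q)`
(`IsBesovMildSolutionOn`) with `‖U t‖_{Ḃ^{s_p}_{p,q}} ≤ M` frequently as `t ↑ T` for some finite `M`
(Albritton's hypothesis (3.2) of §3, i.e. `liminf_{t ↑ T} ‖U t‖ < ∞`). Then `u` is essentially
bounded on every backward parabolic cylinder `Q_r(T, x₀) = (T - r², T) × B(x₀, r)` with `r² < T`:
by Thm. 1.1 in continuation form (`albritton_besov_blowup.exists_extension`) `u` is extended past `T`
by a Besov mild solution `v` on `[0, T')`, `T' > T`, which lies in Kato's class `K_∞` and is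
therefore bounded on the cylinders below `T`
(`MemKatoClassOn.eLpNorm_uncurry_top_parabolicCylinder_lt_top`), and `u = v` a.e. there
(`eLpNorm_uncurry_top_parabolicCylinder_congr`). (Albritton 2018, Thm. 1.1 with Thm. 4.2 (i):
a finite `liminf` of the critical norm at `T` forces `T < T*`, and `u ∈ L^∞` locally on
`(0, T*) × ℝ³`.) [cite: Albritton2018, Thm. 1.1] -/
theorem albritton_besov_blowup.eLpNorm_uncurry_top_parabolicCylinder_lt_top
    (h : albritton_besov_blowup) {ν : ℝ} (hν : 0 < ν) {p q : ℝ≥0∞} [Fact (1 ≤ p)] (hp₃ : 3 < p)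
    (hp : p < ∞) (hq₃ : 3 < q) (hq : q < ∞) {T : ℝ} (hT : 0 < T)
    {u : ℝ → EuclideanSpace ℝ (Fin 3) → EuclideanSpace ℝ (Fin 3)}
    {U : ℝ → 𝓢'(EuclideanSpace ℝ (Fin 3), EuclideanSpace ℂ (Fin 3))}
    (hu : IsBesovMildSolutionOn (-1 + 3 / p.toReal) p q T ν u U)
    (hM : ∃ M : ℝ≥0, ∃ᶠ t in 𝓝[<] T,
      FunctionSpaces.eHomBesovNorm (-1 + 3 / p.toReal) p q (U t) ≤ M)
    (x₀ : EuclideanSpace ℝ (Fin 3)) {r : ℝ} (hrT : r ^ 2 < T) :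
    eLpNorm (uncurry u) ∞ (volume.restrict (parabolicCylinder r (T, x₀))) < ∞ := by
  obtain ⟨T', hT', v, V, hv, hvu⟩ := h.exists_extension hν hp₃ hp hq₃ hq hT hu hM
  rw [eLpNorm_uncurry_top_parabolicCylinder_congr hu.aestronglyMeasurable hv.aestronglyMeasurable
    hT'.le hvu x₀ hrT]
  exact hv.memKatoClassOn.eLpNorm_uncurry_top_parabolicCylinder_lt_top hv.aestronglyMeasurable hT'
    x₀ hrT

-- `linter.deprecated` is switched off for the next declaration only: its hypothesis is the
-- deprecated (mis-stated, 2026-08-15) tree-class rendering `albritton_besov_blowup` of Thm. 1.1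
-- (`CriticalRegularity.lean`), kept as such until the faithful `albritton_besov_blowup_pathSpace`
-- is vendored; the corollary records what the vendored `Prop` implies over the tree's class.
set_option linter.deprecated false in
/-- **The retired `albritton_regular_of_liminf_besov` follows from `albritton_besov_blowup`.**
Assume Albritton's Thm. 1.1 (`albritton_besov_blowup`). Then, for `ν > 0`, `3 < p, q < ∞`,
`0 < T`, every Besov mild solution `(u, U)` on `[0, T)` of the class `(s_p, p, q)` with
`liminf_{t ↑ T} ‖U t‖_{Ḃ^{s_p}_{p,q}} < ∞` (some level undershot frequently as `t ↑ T`, Albritton's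
(3.2)) is regular at every point `(T, x₀)`: `u` is essentially bounded on some backward cylinder
`Q_r(T, x₀)`, `r > 0` (take `r = √(T/2)`, `r² = T/2 < T`, in
`albritton_besov_blowup.eLpNorm_uncurry_top_parabolicCylinder_lt_top`). For `p = q` this is
verbatim the statement that the first decomposition of `albritton_besov_blowup` had vendored as
the named fact `albritton_regular_of_liminf_besov` ("§3, Steps 1–3"); it is thus a corollary of
the parent and was retired (review of the split, 2026-08-15, D-0026).
[cite: Albritton2018, Thm. 1.1 and §3 (3.2)] -/
theorem albritton_besov_blowup.regular_of_frequently_le (h : albritton_besov_blowup) {ν : ℝ}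
    (hν : 0 < ν) {p q : ℝ≥0∞} [Fact (1 ≤ p)] (hp₃ : 3 < p) (hp : p < ∞) (hq₃ : 3 < q) (hq : q < ∞)
    {T : ℝ} (hT : 0 < T) {u : ℝ → EuclideanSpace ℝ (Fin 3) → EuclideanSpace ℝ (Fin 3)}
    {U : ℝ → 𝓢'(EuclideanSpace ℝ (Fin 3), EuclideanSpace ℂ (Fin 3))}
    (hu : IsBesovMildSolutionOn (-1 + 3 / p.toReal) p q T ν u U)
    (hM : ∃ M : ℝ≥0, ∃ᶠ t in 𝓝[<] T,
      FunctionSpaces.eHomBesovNorm (-1 + 3 / p.toReal) p q (U t) ≤ M) :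
    ∀ x₀ : EuclideanSpace ℝ (Fin 3), ∃ r : ℝ, 0 < r ∧
      eLpNorm (uncurry u) ∞ (volume.restrict (parabolicCylinder r (T, x₀))) < ∞ := by
  intro x₀
  refine ⟨Real.sqrt (T / 2), Real.sqrt_pos.2 (half_pos hT), ?_⟩
  refine h.eLpNorm_uncurry_top_parabolicCylinder_lt_top hν hp₃ hp hq₃ hq hT hu hM x₀ ?_
  rw [Real.sq_sqrt (half_pos hT).le]
  exact half_lt_self hT

end Literature.Analysis.FluidPDE

end
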